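import Summits.HodgeConjecture.HodgeConjecture.Theorems.F0P3cStCharTSTorusRay              -- ★ p849400 (LH6-p05 (g2)) «TOR-DATA★» HAND 2: `exists_rayGenerator_shells` (shells `aⁿ • M_c` cover `M`); brings ★ HAND 1 `…TorusCompactPart` (`M_c` measurable, `μ(M_c) < ∞`)
import Summits.HodgeConjecture.HodgeConjecture.Theorems.F0P3cStCharTSShellWeight           -- ★ (LH1-p03) «SHELL-WEIGHT★»: `unitModulusChar_eq_normAbs`, `normAbs_eq_one_of_valued_eq_one` (`‖u‖ = 1` on `M_c`)
import Literature.NumberTheory.Automorphic.CMLocalRingModulusContinuous                         -- ★ `continuous_unitModulusChar`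
import Literature.NumberTheory.Automorphic.CMXiTorusCharSplitTorusDecay                         -- ★ `unitModulusChar_lt_one_of_forall_v_lt_one`
import HarnessLib

/-!
# F0 · P3c · line LH6 «StCharTS» — «(L1M) SPLIT★» §1: an `L¹(M)` criterion on the split torus `M = E_vˣ × E¹_v` —
# bounded on the compact part `M_c`, shell decay `≤ C · min(‖α‖, ‖α‖⁻¹)^s` (`s > 0`) off it [Rogawski1990 §12.7 L. 12.7.2 (proof) p. 193]

Cell `pub/hodgecm-mathlib`, crux H413 = `stmt-HodgeConjecture-24833` (`--supports` lane, helper), route HCCMUnconditional; seat LH6-p01 (g3), integrator of the (TOR) road.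
THEOREMS ONLY, sorry-free, ★-only imports; no definition ∕ instance ∕ notation ∕ named fact.

WHAT THIS IS FOR.  After ★ ₇ (`…SaHeadTorus7`, p850674) the torus block of the leaf's (S-𝔇) is (CHAR-CL) + Casselman's two integrability sentences (L1M) «for all
square-integrable `π`, the restriction of `D_G(γ)χ_π(γ)` to `M` is an integrable function» and (L1M-up) [L. 12.7.2 (proof) p. 193], at `D_G = |D_G|^{1∕2} = Δ ∘ ι`.
Print proves (L1M) by TWO pointwise facts: OFF the compact part `M_c = 𝒪_vˣ × E¹_v` «by Casselman's theorem `χ_π(γ) = χ_{π_N}(γ)` … the exponents of `π_N` decay since `π`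
is square-integrable [C]» (so `|D_G χ_π(ι(α, z))| ≤ C‖α‖^s`, `s > 0`, for `‖α‖ < 1`, and symmetrically), and ON `M_c` Harish-Chandra's local boundedness of `|D_G|^{1∕2}χ_π`
[§1.6 p. 6].  THIS FILE is the measure-theoretic junction that turns the two pointwise facts into the `Integrable` statement, for ANY function `F : M → ℂ` and ANY Haar
measure `μM` on `M`:
* `integrable_of_compactPart_bound_of_shell_decay` — `F` a.e.-strongly measurable, `‖F‖ ≤ B` on `M_c`, `‖F m‖ ≤ C · min(‖m.1‖, ‖m.1‖⁻¹)^s` off `M_c` with `s > 0`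
  ⟹ `Integrable F μM`.
PROOF.  `M_c` is open-compact of finite measure (★ HAND 1), so `F` is integrable on it (bounded on a finite-measure set).  Off `M_c`: with the ray generator `a = (ϖ, 1)` of
★ HAND 2 (`M = ⊔_n aⁿ • M_c`), `‖m.1‖ = ‖ϖ‖ⁿ` on the shell `aⁿ • M_c` (`‖·‖` multiplicative, `= 1` on `𝒪_vˣ` ★), `c := ‖ϖ‖ ∈ (0, 1)` (★ `unitModulusChar_lt_one_of_forall_v_lt_one`),
so `min(‖m.1‖, ‖m.1‖⁻¹)^s = (c^s)^{|n|}` there, each shell has mass `μM(M_c)` (left invariance), and `Σ_{n ∈ ℤ} (c^s)^{|n|} < ∞`; hence the dominating function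
`C · min(‖·‖, ‖·‖⁻¹)^s` is integrable off `M_c` (`lintegral_iUnion_le` over the shells) and `F` with it.
HONEST LABEL: HC_CM is proved only modulo the 7 printed citations (2 remaining: hLiu418 = stmt-HodgeConjecture-24832, h413 = stmt-HodgeConjecture-24833) until rung 0
closes; count-neutral (a junction lemma; it discharges nothing by itself).

## References
* [Rogawski1990] J. D. Rogawski, *Automorphic Representations of Unitary Groups in Three Variables*, Ann. of Math. Stud. 123 (1990), §12.7 L. 12.7.2 (proof) p. 193;
  §12.2 p. 173 (`M ≅ E* × E¹`).
* [Casselman1977] W. Casselman, *Characters and Jacquet modules*, Math. Ann. 230 (1977), Thm. 5.2 (the decay input, cited p. 193 as [C]).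
* [WeilBNT1967] A. Weil, *Basic Number Theory* (1967), Ch. I §4 (the module on a local field; shells of `E_vˣ`).
-/


set_option autoImplicit false
-- the mandated namespace has the single-problem summit's repeated segment (`HodgeConjecture.HodgeConjecture`)
set_option linter.dupNamespace false

noncomputable section

open NumberField IsDedekindDomain MeasureTheory MeasureTheory.Measure Filter Topology Set
open scoped NNReal ENNReal Pointwise
open Literature.NumberTheory.Automorphic Literature.NumberTheory.Automorphic.UnitaryGroup
open Summit.HodgeConjecture.HodgeConjecture.Cruxes.H413.F0P3cStCharTSTorusCompactPart
open Summit.HodgeConjecture.HodgeConjecture.Cruxes.H413.F0P3cStCharTSTorusRay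
open Summit.HodgeConjecture.HodgeConjecture.Cruxes.H413.F0P3cStCharTSShellWeight

namespace Summit.HodgeConjecture.HodgeConjecture.Cruxes.H413.F0P3cStCharTSL1MSplit

/-! ## §0 A real-analysis trivium -/

/-- For `0 < c < 1`: `min(cⁿ, c⁻ⁿ) = c^{|n|}` (`n ∈ ℤ`). [cite: Rogawski1990, §12.7 L. 12.7.2 (proof) p. 193] -/
theorem min_zpow_inv_eq_pow_natAbs {c : ℝ} (hc0 : 0 < c) (hc1 : c < 1) (n : ℤ) : min (c ^ n) (c ^ n)⁻¹ = c ^ n.natAbs := by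
  have key : ∀ k : ℕ, c ^ k ≤ (c ^ k)⁻¹ := fun k =>
    (pow_le_one₀ hc0.le hc1.le).trans ((one_le_inv₀ (pow_pos hc0 k)).2 (pow_le_one₀ hc0.le hc1.le))
  rcases Int.natAbs_eq n with h | h
  · rw [h, Int.natAbs_natCast, zpow_natCast]
    exact min_eq_left (key _)
  · rw [h, Int.natAbs_neg, Int.natAbs_natCast, zpow_neg, zpow_natCast, inv_inv]
    exact min_eq_right (key _)

/-! ## §1 The module `‖·‖` on the shells of `M = E_vˣ × E¹_v` -/

section CM

variable (L : Type) [Field L] [NumberField L] [IsCMField L] (v : HeightOneSpectrum (𝓞 ↥(maximalRealSubfield L)))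

omit [IsCMField L] in
/-- `‖x⁻¹‖ = ‖x‖⁻¹` for the module ★ `unitModulusChar` (a monoid hom on the unit group into `ℝ≥0`). [cite: WeilBNT1967, Ch. I §4] -/
theorem unitModulusChar_inv (x : (LocalRing L v)ˣ) : unitModulusChar (LocalRing L v) x⁻¹ = (unitModulusChar (LocalRing L v) x)⁻¹ :=
  eq_inv_of_mul_eq_one_left (by rw [← map_mul, inv_mul_cancel, map_one])

omit [IsCMField L] in
/-- `‖x‖ ≠ 0`. [cite: WeilBNT1967, Ch. I §4] -/
theorem unitModulusChar_ne_zero (x : (LocalRing L v)ˣ) : unitModulusChar (LocalRing L v) x ≠ 0 := fun h0 => by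
  have h1 : unitModulusChar (LocalRing L v) x⁻¹ * unitModulusChar (LocalRing L v) x = 1 := by rw [← map_mul, inv_mul_cancel, map_one]
  rw [h0, mul_zero] at h1
  exact zero_ne_one h1

/-- **`‖m.1‖ = ‖a.1‖ⁿ` on the shell `aⁿ • M_c`** (`‖·‖` multiplicative, `= 1` on `𝒪_vˣ` at a non-split `v`). [cite: Rogawski1990, §12.7 L. 12.7.2 (proof) p. 193; §12.2 p. 173] -/
theorem coe_unitModulusChar_fst_of_mem_shell (hns : ∀ w : PlacesOver L v, IsCMField.complexConj L • w.1 = w.1)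
    (a : ((LocalRing L v)ˣ × ↥(normOneUnits (conjLocal L (IsCMField.complexConj L) v)))) (n : ℤ) {m : ((LocalRing L v)ˣ × ↥(normOneUnits (conjLocal L (IsCMField.complexConj L) v)))}
    (hm : m ∈ a ^ n • (((((Submonoid.pi Set.univ (fun w : PlacesOver L v => (w.1.adicCompletionIntegers L).toSubring.toSubmonoid)).units.prod (⊤ : Subgroup ↥(normOneUnits (conjLocal L (IsCMField.complexConj L) v)))) : Subgroup ((LocalRing L v)ˣ × ↥(normOneUnits (conjLocal L (IsCMField.complexConj L) v))))) : Set ((LocalRing L v)ˣ × ↥(normOneUnits (conjLocal L (IsCMField.complexConj L) v))))) :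
    ((unitModulusChar (LocalRing L v) m.1 : ℝ≥0) : ℝ) = ((unitModulusChar (LocalRing L v) a.1 : ℝ≥0) : ℝ) ^ n := by
  obtain ⟨w⟩ : Nonempty (PlacesOver L v) := inferInstance
  obtain ⟨u, hu, rfl⟩ := mem_smul_set.1 hm
  have hu1 : unitModulusChar (LocalRing L v) u.1 = 1 := by
    rw [unitModulusChar_eq_normAbs L v w (hns w) u.1]
    exact normAbs_eq_one_of_valued_eq_one w.1 ((mem_unitsIntegers_iff L v u.1).1 (Subgroup.mem_prod.1 hu).1 w)
  have h1 : (a ^ n • u).1 = a.1 ^ n * u.1 := rfl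
  rw [h1, map_mul, hu1, mul_one, map_zpow' (unitModulusChar (LocalRing L v)) (unitModulusChar_inv L v) a.1 n, NNReal.coe_zpow]

/-- Shells `x • M_c` are measurable (translates of the open `M_c`). [cite: Rogawski1990, §12.7 L. 12.7.2 (proof) p. 193] -/
theorem measurableSet_smul_torusCompactPart [MeasurableSpace ((LocalRing L v)ˣ × ↥(normOneUnits (conjLocal L (IsCMField.complexConj L) v)))] [BorelSpace ((LocalRing L v)ˣ × ↥(normOneUnits (conjLocal L (IsCMField.complexConj L) v)))] (x : ((LocalRing L v)ˣ × ↥(normOneUnits (conjLocal L (IsCMField.complexConj L) v)))) :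
    MeasurableSet (x • (((((Submonoid.pi Set.univ (fun w : PlacesOver L v => (w.1.adicCompletionIntegers L).toSubring.toSubmonoid)).units.prod (⊤ : Subgroup ↥(normOneUnits (conjLocal L (IsCMField.complexConj L) v)))) : Subgroup ((LocalRing L v)ˣ × ↥(normOneUnits (conjLocal L (IsCMField.complexConj L) v))))) : Set ((LocalRing L v)ˣ × ↥(normOneUnits (conjLocal L (IsCMField.complexConj L) v))))) := by
  rw [← preimage_smul_inv]
  exact (continuous_const_smul _).measurable (measurableSet_torusCompactPart L v)

/-! ## §2 The dominating function `C · min(‖·‖, ‖·‖⁻¹)^s` is integrable off `M_c` -/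

/-- **The shell-decay majorant is integrable off the compact part**: for `s > 0` and any Haar measure `μM` on `M`, `m ↦ C · min(‖m.1‖, ‖m.1‖⁻¹)^s` is integrable on `M ∖ M_c` —
shells `aⁿ • M_c` of equal mass `μM(M_c)`, value `C · (‖ϖ‖^s)^{|n|}` on the `n`-th, `Σ_n (‖ϖ‖^s)^{|n|} < ∞`. [cite: Rogawski1990, §12.7 Lemma 12.7.2 (proof) p. 193] [cite: WeilBNT1967, Ch. I §4] -/
theorem integrableOn_shellDecay_compl (hns : ∀ w : PlacesOver L v, IsCMField.complexConj L • w.1 = w.1)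
    [MeasurableSpace ((LocalRing L v)ˣ × ↥(normOneUnits (conjLocal L (IsCMField.complexConj L) v)))] [BorelSpace ((LocalRing L v)ˣ × ↥(normOneUnits (conjLocal L (IsCMField.complexConj L) v)))]
    (μM : Measure ((LocalRing L v)ˣ × ↥(normOneUnits (conjLocal L (IsCMField.complexConj L) v)))) [μM.IsHaarMeasure] (C s : ℝ) (hs : 0 < s) :
    IntegrableOn (fun m : ((LocalRing L v)ˣ × ↥(normOneUnits (conjLocal L (IsCMField.complexConj L) v))) => C * (min ((unitModulusChar (LocalRing L v) m.1 : ℝ≥0) : ℝ) ((unitModulusChar (LocalRing L v) m.1 : ℝ≥0) : ℝ)⁻¹) ^ s) (((((Submonoid.pi Set.univ (fun w : PlacesOver L v => (w.1.adicCompletionIntegers L).toSubring.toSubmonoid)).units.prod (⊤ : Subgroup ↥(normOneUnits (conjLocal L (IsCMField.complexConj L) v)))) : Subgroup ((LocalRing L v)ˣ × ↥(normOneUnits (conjLocal L (IsCMField.complexConj L) v))))) : Set ((LocalRing L v)ˣ × ↥(normOneUnits (conjLocal L (IsCMField.complexConj L) v))))ᶜ μM := by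
  have hMcm : MeasurableSet (((((Submonoid.pi Set.univ (fun w : PlacesOver L v => (w.1.adicCompletionIntegers L).toSubring.toSubmonoid)).units.prod (⊤ : Subgroup ↥(normOneUnits (conjLocal L (IsCMField.complexConj L) v)))) : Subgroup ((LocalRing L v)ˣ × ↥(normOneUnits (conjLocal L (IsCMField.complexConj L) v))))) : Set ((LocalRing L v)ˣ × ↥(normOneUnits (conjLocal L (IsCMField.complexConj L) v)))) := measurableSet_torusCompactPart L v
  have hfin : μM (((((Submonoid.pi Set.univ (fun w : PlacesOver L v => (w.1.adicCompletionIntegers L).toSubring.toSubmonoid)).units.prod (⊤ : Subgroup ↥(normOneUnits (conjLocal L (IsCMField.complexConj L) v)))) : Subgroup ((LocalRing L v)ˣ × ↥(normOneUnits (conjLocal L (IsCMField.complexConj L) v))))) : Set ((LocalRing L v)ˣ × ↥(normOneUnits (conjLocal L (IsCMField.complexConj L) v)))) < ⊤ := measure_torusCompactPart_lt_top L v hns μM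
  -- measurability of the majorant
  have hqm : Measurable fun m : ((LocalRing L v)ˣ × ↥(normOneUnits (conjLocal L (IsCMField.complexConj L) v))) => ((unitModulusChar (LocalRing L v) m.1 : ℝ≥0) : ℝ) :=
    (NNReal.continuous_coe.comp ((continuous_unitModulusChar L v).comp continuous_fst)).measurable
  refine ⟨(measurable_const.mul ((hqm.min hqm.inv).pow_const s)).aestronglyMeasurable, ?_⟩
  -- the ray generator `a = (ϖ, 1)` and its readings
  obtain ⟨a, -, hϖ, -, -, hgen, -⟩ := exists_rayGenerator_shells L v hns
  have hc1 : ((unitModulusChar (LocalRing L v) a.1 : ℝ≥0) : ℝ) < 1 := by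
    have h := unitModulusChar_lt_one_of_forall_v_lt_one (L := L) (v := v) a.1 fun w' => by
      rw [hϖ w', ← WithZero.exp_zero]; exact WithZero.exp_lt_exp.2 (by norm_num)
    exact NNReal.coe_lt_one.2 h
  have hc0 : 0 < ((unitModulusChar (LocalRing L v) a.1 : ℝ≥0) : ℝ) := NNReal.coe_pos.2 (pos_iff_ne_zero.2 (unitModulusChar_ne_zero L v a.1))
  have hr0 : 0 ≤ ((unitModulusChar (LocalRing L v) a.1 : ℝ≥0) : ℝ) ^ s := Real.rpow_nonneg hc0.le s
  have hr1 : ((unitModulusChar (LocalRing L v) a.1 : ℝ≥0) : ℝ) ^ s < 1 := Real.rpow_lt_one hc0.le hc1 hs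
  have hcomm : ∀ k : ℕ, (((unitModulusChar (LocalRing L v) a.1 : ℝ≥0) : ℝ) ^ k) ^ s = (((unitModulusChar (LocalRing L v) a.1 : ℝ≥0) : ℝ) ^ s) ^ k := fun k => by
    rw [← Real.rpow_natCast _ k, ← Real.rpow_mul hc0.le, mul_comm, Real.rpow_mul hc0.le, Real.rpow_natCast]
  have hsum0 : Summable fun n : ℤ => (((unitModulusChar (LocalRing L v) a.1 : ℝ≥0) : ℝ) ^ s) ^ n.natAbs := by
    refine summable_int_iff_summable_nat_and_neg.2 ⟨?_, ?_⟩
    · simpa only [Int.natAbs_natCast] using summable_geometric_of_lt_one hr0 hr1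
    · simpa only [Int.natAbs_neg, Int.natAbs_natCast] using summable_geometric_of_lt_one hr0 hr1
  -- the value of the majorant on the `n`-th shell
  have hg_shell : ∀ (n : ℤ) (m : ((LocalRing L v)ˣ × ↥(normOneUnits (conjLocal L (IsCMField.complexConj L) v)))), m ∈ a ^ n • (((((Submonoid.pi Set.univ (fun w : PlacesOver L v => (w.1.adicCompletionIntegers L).toSubring.toSubmonoid)).units.prod (⊤ : Subgroup ↥(normOneUnits (conjLocal L (IsCMField.complexConj L) v)))) : Subgroup ((LocalRing L v)ˣ × ↥(normOneUnits (conjLocal L (IsCMField.complexConj L) v))))) : Set ((LocalRing L v)ˣ × ↥(normOneUnits (conjLocal L (IsCMField.complexConj L) v)))) →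
      ‖C * (min ((unitModulusChar (LocalRing L v) m.1 : ℝ≥0) : ℝ) ((unitModulusChar (LocalRing L v) m.1 : ℝ≥0) : ℝ)⁻¹) ^ s‖ₑ ≤ ENNReal.ofReal (|C| * (((unitModulusChar (LocalRing L v) a.1 : ℝ≥0) : ℝ) ^ s) ^ n.natAbs) := by
    intro n m hm
    rw [coe_unitModulusChar_fst_of_mem_shell L v hns a n hm, min_zpow_inv_eq_pow_natAbs hc0 hc1 n, hcomm,
      Real.enorm_eq_ofReal_abs, abs_mul, abs_of_nonneg (pow_nonneg hr0 _)]
  -- `M ∖ M_c ⊆ ⋃_n aⁿ • M_c`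
  have hcover : (((((Submonoid.pi Set.univ (fun w : PlacesOver L v => (w.1.adicCompletionIntegers L).toSubring.toSubmonoid)).units.prod (⊤ : Subgroup ↥(normOneUnits (conjLocal L (IsCMField.complexConj L) v)))) : Subgroup ((LocalRing L v)ˣ × ↥(normOneUnits (conjLocal L (IsCMField.complexConj L) v))))) : Set ((LocalRing L v)ˣ × ↥(normOneUnits (conjLocal L (IsCMField.complexConj L) v))))ᶜ ⊆ ⋃ n : ℤ, a ^ n • (((((Submonoid.pi Set.univ (fun w : PlacesOver L v => (w.1.adicCompletionIntegers L).toSubring.toSubmonoid)).units.prod (⊤ : Subgroup ↥(normOneUnits (conjLocal L (IsCMField.complexConj L) v)))) : Subgroup ((LocalRing L v)ˣ × ↥(normOneUnits (conjLocal L (IsCMField.complexConj L) v))))) : Set ((LocalRing L v)ˣ × ↥(normOneUnits (conjLocal L (IsCMField.complexConj L) v)))) := by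
    intro m _
    obtain ⟨n, u, hu, rfl⟩ := hgen m
    exact mem_iUnion.2 ⟨n, mem_smul_set.2 ⟨u, hu, smul_eq_mul _ _⟩⟩
  have hsum : Summable fun n : ℤ => |C| * (((unitModulusChar (LocalRing L v) a.1 : ℝ≥0) : ℝ) ^ s) ^ n.natAbs := hsum0.mul_left _
  -- the estimate
  show ∫⁻ m in (((((Submonoid.pi Set.univ (fun w : PlacesOver L v => (w.1.adicCompletionIntegers L).toSubring.toSubmonoid)).units.prod (⊤ : Subgroup ↥(normOneUnits (conjLocal L (IsCMField.complexConj L) v)))) : Subgroup ((LocalRing L v)ˣ × ↥(normOneUnits (conjLocal L (IsCMField.complexConj L) v))))) : Set ((LocalRing L v)ˣ × ↥(normOneUnits (conjLocal L (IsCMField.complexConj L) v))))ᶜ, ‖C * (min ((unitModulusChar (LocalRing L v) m.1 : ℝ≥0) : ℝ) ((unitModulusChar (LocalRing L v) m.1 : ℝ≥0) : ℝ)⁻¹) ^ s‖ₑ ∂μM < ⊤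
  calc ∫⁻ m in (((((Submonoid.pi Set.univ (fun w : PlacesOver L v => (w.1.adicCompletionIntegers L).toSubring.toSubmonoid)).units.prod (⊤ : Subgroup ↥(normOneUnits (conjLocal L (IsCMField.complexConj L) v)))) : Subgroup ((LocalRing L v)ˣ × ↥(normOneUnits (conjLocal L (IsCMField.complexConj L) v))))) : Set ((LocalRing L v)ˣ × ↥(normOneUnits (conjLocal L (IsCMField.complexConj L) v))))ᶜ, ‖C * (min ((unitModulusChar (LocalRing L v) m.1 : ℝ≥0) : ℝ) ((unitModulusChar (LocalRing L v) m.1 : ℝ≥0) : ℝ)⁻¹) ^ s‖ₑ ∂μM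
      ≤ ∫⁻ m in ⋃ n : ℤ, a ^ n • (((((Submonoid.pi Set.univ (fun w : PlacesOver L v => (w.1.adicCompletionIntegers L).toSubring.toSubmonoid)).units.prod (⊤ : Subgroup ↥(normOneUnits (conjLocal L (IsCMField.complexConj L) v)))) : Subgroup ((LocalRing L v)ˣ × ↥(normOneUnits (conjLocal L (IsCMField.complexConj L) v))))) : Set ((LocalRing L v)ˣ × ↥(normOneUnits (conjLocal L (IsCMField.complexConj L) v)))), ‖C * (min ((unitModulusChar (LocalRing L v) m.1 : ℝ≥0) : ℝ) ((unitModulusChar (LocalRing L v) m.1 : ℝ≥0) : ℝ)⁻¹) ^ s‖ₑ ∂μM := lintegral_mono_set hcover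
    _ ≤ ∑' n : ℤ, ∫⁻ m in a ^ n • (((((Submonoid.pi Set.univ (fun w : PlacesOver L v => (w.1.adicCompletionIntegers L).toSubring.toSubmonoid)).units.prod (⊤ : Subgroup ↥(normOneUnits (conjLocal L (IsCMField.complexConj L) v)))) : Subgroup ((LocalRing L v)ˣ × ↥(normOneUnits (conjLocal L (IsCMField.complexConj L) v))))) : Set ((LocalRing L v)ˣ × ↥(normOneUnits (conjLocal L (IsCMField.complexConj L) v)))), ‖C * (min ((unitModulusChar (LocalRing L v) m.1 : ℝ≥0) : ℝ) ((unitModulusChar (LocalRing L v) m.1 : ℝ≥0) : ℝ)⁻¹) ^ s‖ₑ ∂μM := lintegral_iUnion_le _ _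
    _ ≤ ∑' n : ℤ, ∫⁻ _ in a ^ n • (((((Submonoid.pi Set.univ (fun w : PlacesOver L v => (w.1.adicCompletionIntegers L).toSubring.toSubmonoid)).units.prod (⊤ : Subgroup ↥(normOneUnits (conjLocal L (IsCMField.complexConj L) v)))) : Subgroup ((LocalRing L v)ˣ × ↥(normOneUnits (conjLocal L (IsCMField.complexConj L) v))))) : Set ((LocalRing L v)ˣ × ↥(normOneUnits (conjLocal L (IsCMField.complexConj L) v)))), ENNReal.ofReal (|C| * (((unitModulusChar (LocalRing L v) a.1 : ℝ≥0) : ℝ) ^ s) ^ n.natAbs) ∂μM :=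
        ENNReal.tsum_le_tsum fun n => setLIntegral_mono' (measurableSet_smul_torusCompactPart L v (a ^ n)) fun m hm => hg_shell n m hm
    _ = ∑' n : ℤ, ENNReal.ofReal (|C| * (((unitModulusChar (LocalRing L v) a.1 : ℝ≥0) : ℝ) ^ s) ^ n.natAbs) * μM (((((Submonoid.pi Set.univ (fun w : PlacesOver L v => (w.1.adicCompletionIntegers L).toSubring.toSubmonoid)).units.prod (⊤ : Subgroup ↥(normOneUnits (conjLocal L (IsCMField.complexConj L) v)))) : Subgroup ((LocalRing L v)ˣ × ↥(normOneUnits (conjLocal L (IsCMField.complexConj L) v))))) : Set ((LocalRing L v)ˣ × ↥(normOneUnits (conjLocal L (IsCMField.complexConj L) v)))) := by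
        refine tsum_congr fun n => ?_
        rw [setLIntegral_const, measure_smul]
    _ = (∑' n : ℤ, ENNReal.ofReal (|C| * (((unitModulusChar (LocalRing L v) a.1 : ℝ≥0) : ℝ) ^ s) ^ n.natAbs)) * μM (((((Submonoid.pi Set.univ (fun w : PlacesOver L v => (w.1.adicCompletionIntegers L).toSubring.toSubmonoid)).units.prod (⊤ : Subgroup ↥(normOneUnits (conjLocal L (IsCMField.complexConj L) v)))) : Subgroup ((LocalRing L v)ˣ × ↥(normOneUnits (conjLocal L (IsCMField.complexConj L) v))))) : Set ((LocalRing L v)ˣ × ↥(normOneUnits (conjLocal L (IsCMField.complexConj L) v)))) := ENNReal.tsum_mul_right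
    _ = ENNReal.ofReal (∑' n : ℤ, |C| * (((unitModulusChar (LocalRing L v) a.1 : ℝ≥0) : ℝ) ^ s) ^ n.natAbs) * μM (((((Submonoid.pi Set.univ (fun w : PlacesOver L v => (w.1.adicCompletionIntegers L).toSubring.toSubmonoid)).units.prod (⊤ : Subgroup ↥(normOneUnits (conjLocal L (IsCMField.complexConj L) v)))) : Subgroup ((LocalRing L v)ˣ × ↥(normOneUnits (conjLocal L (IsCMField.complexConj L) v))))) : Set ((LocalRing L v)ˣ × ↥(normOneUnits (conjLocal L (IsCMField.complexConj L) v)))) := by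
        rw [ENNReal.ofReal_tsum_of_nonneg (fun n => mul_nonneg (abs_nonneg C) (pow_nonneg hr0 _)) hsum]
    _ < ⊤ := ENNReal.mul_lt_top ENNReal.ofReal_lt_top hfin

/-! ## §3 The `L¹(M)` criterion -/

/-- **«(L1M) SPLIT★» — AN `L¹(M)` CRITERION ON THE SPLIT TORUS `M = E_vˣ × E¹_v` (non-split `v`, any Haar measure `μM`):** if `F : M → ℂ` is a.e.-strongly measurable,
bounded by `B` on the compact part `M_c = 𝒪_vˣ × E¹_v`, and satisfies the SHELL DECAY `‖F m‖ ≤ C · min(‖m.1‖, ‖m.1‖⁻¹)^s` off `M_c` for some `s > 0` (`‖·‖` = ★ `unitModulusChar`,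
the module of `E_v`), then `F ∈ L¹(M, μM)`.  This is the junction of print's proof of (L1M) «the restriction of `D_G(γ)χ_π(γ)` to `M` is an integrable function»: OFF `M_c` the
decay of the Jacquet exponents [C], ON `M_c` Harish-Chandra's local boundedness.  Proof: `M_c` has finite measure (★ HAND 1), §2 off `M_c`.
[cite: Rogawski1990, §12.7 Lemma 12.7.2 (proof) p. 193; §12.2 p. 173] [cite: Casselman1977, Thm. 5.2] [cite: WeilBNT1967, Ch. I §4] -/
theorem integrable_of_compactPart_bound_of_shell_decay
    (hns : ∀ w : PlacesOver L v, IsCMField.complexConj L • w.1 = w.1)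
    [MeasurableSpace ((LocalRing L v)ˣ × ↥(normOneUnits (conjLocal L (IsCMField.complexConj L) v)))] [BorelSpace ((LocalRing L v)ˣ × ↥(normOneUnits (conjLocal L (IsCMField.complexConj L) v)))]
    (μM : Measure ((LocalRing L v)ˣ × ↥(normOneUnits (conjLocal L (IsCMField.complexConj L) v)))) [μM.IsHaarMeasure]
    (F : ((LocalRing L v)ˣ × ↥(normOneUnits (conjLocal L (IsCMField.complexConj L) v))) → ℂ) (hF : AEStronglyMeasurable F μM)
    (B : ℝ) (hB : ∀ m : ((LocalRing L v)ˣ × ↥(normOneUnits (conjLocal L (IsCMField.complexConj L) v))), m ∈ (((Submonoid.pi Set.univ (fun w : PlacesOver L v => (w.1.adicCompletionIntegers L).toSubring.toSubmonoid)).units.prod (⊤ : Subgroup ↥(normOneUnits (conjLocal L (IsCMField.complexConj L) v)))) : Subgroup ((LocalRing L v)ˣ × ↥(normOneUnits (conjLocal L (IsCMField.complexConj L) v)))) → ‖F m‖ ≤ B)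
    (C s : ℝ) (hs : 0 < s)
    (hC : ∀ m : ((LocalRing L v)ˣ × ↥(normOneUnits (conjLocal L (IsCMField.complexConj L) v))), m ∉ (((Submonoid.pi Set.univ (fun w : PlacesOver L v => (w.1.adicCompletionIntegers L).toSubring.toSubmonoid)).units.prod (⊤ : Subgroup ↥(normOneUnits (conjLocal L (IsCMField.complexConj L) v)))) : Subgroup ((LocalRing L v)ˣ × ↥(normOneUnits (conjLocal L (IsCMField.complexConj L) v)))) →
      ‖F m‖ ≤ C * (min ((unitModulusChar (LocalRing L v) m.1 : ℝ≥0) : ℝ) ((unitModulusChar (LocalRing L v) m.1 : ℝ≥0) : ℝ)⁻¹) ^ s) :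
    Integrable F μM := by
  have hMcm : MeasurableSet (((((Submonoid.pi Set.univ (fun w : PlacesOver L v => (w.1.adicCompletionIntegers L).toSubring.toSubmonoid)).units.prod (⊤ : Subgroup ↥(normOneUnits (conjLocal L (IsCMField.complexConj L) v)))) : Subgroup ((LocalRing L v)ˣ × ↥(normOneUnits (conjLocal L (IsCMField.complexConj L) v))))) : Set ((LocalRing L v)ˣ × ↥(normOneUnits (conjLocal L (IsCMField.complexConj L) v)))) := measurableSet_torusCompactPart L v
  have hfin : μM (((((Submonoid.pi Set.univ (fun w : PlacesOver L v => (w.1.adicCompletionIntegers L).toSubring.toSubmonoid)).units.prod (⊤ : Subgroup ↥(normOneUnits (conjLocal L (IsCMField.complexConj L) v)))) : Subgroup ((LocalRing L v)ˣ × ↥(normOneUnits (conjLocal L (IsCMField.complexConj L) v))))) : Set ((LocalRing L v)ˣ × ↥(normOneUnits (conjLocal L (IsCMField.complexConj L) v)))) < ⊤ := measure_torusCompactPart_lt_top L v hns μM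
  rw [← integrableOn_univ, ← union_compl_self (((((Submonoid.pi Set.univ (fun w : PlacesOver L v => (w.1.adicCompletionIntegers L).toSubring.toSubmonoid)).units.prod (⊤ : Subgroup ↥(normOneUnits (conjLocal L (IsCMField.complexConj L) v)))) : Subgroup ((LocalRing L v)ˣ × ↥(normOneUnits (conjLocal L (IsCMField.complexConj L) v))))) : Set ((LocalRing L v)ˣ × ↥(normOneUnits (conjLocal L (IsCMField.complexConj L) v)))), integrableOn_union]
  refine ⟨Measure.integrableOn_of_bounded hfin.ne hF (ae_restrict_of_forall_mem hMcm fun m hm => hB m hm), ?_⟩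
  exact Integrable.mono' (integrableOn_shellDecay_compl L v hns μM C s hs) hF.restrict
    (ae_restrict_of_forall_mem hMcm.compl fun m hm => hC m hm)

end CM

end Summit.HodgeConjecture.HodgeConjecture.Cruxes.H413.F0P3cStCharTSL1MSplit

end
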